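import Mathlib
import HarnessLib
import HarnessLib.Audit

/-!
# ValiantsHypothesis / LacunarySymmetroid — crux `MatrixDescartes` (stmt-ValiantsHypothesis-18050, V1), LINE (A) «product_plus_one»:
# lemmas for THEOREM D `SmallRatioAtMostTwo` (pen val-idea-25 g9 NOTE §56.18 ≡ crit-1 #422): the algebraic core `K < 0` and a zero-once lemma

* `K_neg_of_ratio_le_two` — the pen's Lean-checked algebraic core of Theorem D (`abprobe/s59/KNegCore.lean`, `K_neg_of_rho_le_two`),
  homogenised from a-units to exponents `c ≤ 2a`: for rates `e_i ≥ 0`, variances `w_i ≥ e_i(a − e_i)`, `ψ = Σe_i > 0` and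
  `ψ(a+ψ) < Σw_i`, `K = −3Σw_i(e_i+ψ) − Σe_i(e_i−a)(e_i−c) + (c+ψ)ψ(a+ψ) < 0` (with `sum_cube_le_cube_sum`);
* `zero_once_of_deriv_neg` — a function differentiable on `(0,∞)` all of whose zeros are strict down-crossings (`f x = 0 ⇒ f′ x < 0`)
  vanishes at most once there (first zero after a zero via `sInf`, one-sided signs from the derivative, intermediate values).

Used by ✓ `…SmallRatio` (`smallRatioAtMostTwo`) through the engine ✓ `…MultiplierQuotient`.  HONEST FRAMING: helper lemmas; nothing here
is about a stub of LINE (A); `OneChangeFloorK3`, `MatrixDescartes` OPEN; `VP ≠ VNP` is NOT proved.  No definitions, no named facts, no sorry.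
-/

set_option linter.dupNamespace false

namespace Summit.ValiantsHypothesis.ValiantsHypothesis.Theorems.LacunarySymmetroidMatrixDescartes

namespace ZeroChange

open Polynomial Finset Set Filter Topology

/-- `Σ e_i³ ≤ (Σ e_i)³` for nonnegative reals (pen g9 `KNegCore.lean`). -/
theorem sum_cube_le_cube_sum {k : ℕ} (e : Fin k → ℝ) (he : ∀ i, 0 ≤ e i) :
    ∑ i, e i ^ 3 ≤ (∑ i, e i) ^ 3 := by
  have hle : ∀ i, e i ≤ ∑ j, e j := fun i =>
    Finset.single_le_sum (f := e) (fun j _ => he j) (Finset.mem_univ i)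
  calc ∑ i, e i ^ 3 ≤ ∑ i, e i * (∑ j, e j) ^ 2 := by
        apply Finset.sum_le_sum
        intro i _
        have h2 : e i ^ 2 ≤ (∑ j, e j) ^ 2 := by
          rw [sq, sq]; exact mul_self_le_mul_self (he i) (hle i)
        calc e i ^ 3 = e i * e i ^ 2 := by ring
          _ ≤ e i * (∑ j, e j) ^ 2 := mul_le_mul_of_nonneg_left h2 (he i)
    _ = (∑ i, e i) * (∑ j, e j) ^ 2 := by rw [Finset.sum_mul]
    _ = (∑ i, e i) ^ 3 := by ring

/-- **THEOREM D, algebraic core** (pen g9 §56.18, `KNegCore.lean` `K_neg_of_rho_le_two`, homogenised to exponents `a ≤ c ≤ 2a`):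
for rates `e_i ≥ 0`, variances `w_i ≥ e_i(a − e_i)`, `ψ = Σe_i > 0` and `ψ(a+ψ) < Σw_i`, the cumulant expression `K` is negative. -/
theorem K_neg_of_ratio_le_two {k : ℕ} (a c : ℝ) (hca : c ≤ 2 * a) (e w : Fin k → ℝ)
    (he : ∀ i, 0 ≤ e i) (hw : ∀ i, e i * (a - e i) ≤ w i)
    (hψ : 0 < ∑ i, e i) (hΩ : (∑ i, e i) * (a + ∑ i, e i) < ∑ i, w i) :
    -3 * ∑ i, w i * (e i + ∑ j, e j) - ∑ i, e i * (e i - a) * (e i - c)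
      + (c + ∑ i, e i) * (∑ i, e i) * (a + ∑ i, e i) < 0 := by
  have hT : ∑ i, e i ^ 2 * (a - e i) ≤ ∑ i, w i * e i := by
    apply Finset.sum_le_sum
    intro i _
    have h := mul_le_mul_of_nonneg_left (hw i) (he i)
    calc e i ^ 2 * (a - e i) = e i * (e i * (a - e i)) := by ring
      _ ≤ e i * w i := h
      _ = w i * e i := by ring
  have h1 : ∑ i, w i * (e i + ∑ j, e j) = ∑ i, w i * e i + (∑ j, e j) * ∑ i, w i := by
    rw [Finset.mul_sum, ← Finset.sum_add_distrib]
    exact Finset.sum_congr rfl fun i _ => by ring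
  have h2 : ∑ i, e i * (e i - a) * (e i - c)
      = ∑ i, e i ^ 3 - (a + c) * ∑ i, e i ^ 2 + a * c * ∑ i, e i := by
    rw [Finset.mul_sum, Finset.mul_sum, ← Finset.sum_sub_distrib, ← Finset.sum_add_distrib]
    exact Finset.sum_congr rfl fun i _ => by ring
  have h3 : ∑ i, e i ^ 2 * (a - e i) = a * ∑ i, e i ^ 2 - ∑ i, e i ^ 3 := by
    rw [Finset.mul_sum, ← Finset.sum_sub_distrib]
    exact Finset.sum_congr rfl fun i _ => by ring
  have hS3 : ∑ i, e i ^ 3 ≤ (∑ i, e i) ^ 3 := sum_cube_le_cube_sum e he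
  have hS2 : 0 ≤ ∑ i, e i ^ 2 := Finset.sum_nonneg (fun i _ => sq_nonneg (e i))
  have hψV : (∑ i, e i) * ((∑ i, e i) * (a + ∑ i, e i)) < (∑ i, e i) * ∑ i, w i :=
    mul_lt_mul_of_pos_left hΩ hψ
  have hA : 0 ≤ (2 * a - c) * ∑ i, e i ^ 2 := mul_nonneg (by linarith) hS2
  have hB : 0 ≤ (2 * a - c) * (∑ i, e i) ^ 2 := mul_nonneg (by linarith) (sq_nonneg _)
  rw [h1, h2]
  nlinarith [hT, h3, hS3, hS2, hψV, hA, hB, hψ]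

/-- **A differentiable function on `(0,∞)` whose zeros are all strict down-crossings vanishes at most once.** -/
theorem zero_once_of_deriv_neg {f f' : ℝ → ℝ} (hf : ∀ x, 0 < x → HasDerivAt f (f' x) x)
    (hneg : ∀ x, 0 < x → f x = 0 → f' x < 0) {x y : ℝ} (hx : 0 < x) (hxy : x < y) (hfx : f x = 0) :
    f y ≠ 0 := by
  intro hfy
  -- right of a zero the function is negative for a while, left of a zero it is positive for a while
  have hright : ∀ z, 0 < z → f z = 0 → ∃ δ > 0, ∀ w, z < w → w < z + δ → f w < 0 := by
    intro z hz hfz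
    have ht := (hf z hz).tendsto_slope_zero_right
    have hev : ∀ᶠ t in 𝓝[>] (0 : ℝ), t⁻¹ • (f (z + t) - f z) < 0 := ht.eventually_lt_const (hneg z hz hfz)
    obtain ⟨u, hu, hsub⟩ := mem_nhdsGT_iff_exists_Ioo_subset.1 hev
    refine ⟨u, hu, fun w hzw hwz => ?_⟩
    have hmem : w - z ∈ Ioo (0 : ℝ) u := ⟨by linarith, by linarith⟩
    have h1 := hsub hmem
    simp only [Set.mem_setOf_eq, hfz, sub_zero, smul_eq_mul, add_sub_cancel] at h1
    have hwz' : 0 < w - z := by linarith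
    by_contra hge
    push Not at hge
    have : 0 ≤ (w - z)⁻¹ * f w := mul_nonneg (inv_nonneg.2 hwz'.le) hge
    linarith
  have hleft : ∀ z, 0 < z → f z = 0 → ∃ δ > 0, ∀ w, z - δ < w → w < z → 0 < f w := by
    intro z hz hfz
    have ht := (hf z hz).tendsto_slope_zero_left
    have hev : ∀ᶠ t in 𝓝[<] (0 : ℝ), t⁻¹ • (f (z + t) - f z) < 0 := ht.eventually_lt_const (hneg z hz hfz)
    obtain ⟨u, hu, hsub⟩ := mem_nhdsLT_iff_exists_Ioo_subset.1 hev
    refine ⟨-u, by simpa using hu, fun w hzw hwz => ?_⟩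
    have hmem : w - z ∈ Ioo u (0 : ℝ) := ⟨by linarith, by linarith⟩
    have h1 := hsub hmem
    simp only [Set.mem_setOf_eq, hfz, sub_zero, smul_eq_mul, add_sub_cancel] at h1
    have hwz' : w - z < 0 := by linarith
    by_contra hle
    push Not at hle
    have : 0 ≤ (w - z)⁻¹ * f w := mul_nonneg_of_nonpos_of_nonpos (inv_nonpos.2 hwz'.le) hle
    linarith
  -- continuity on `(0,∞)`
  have hcont : ∀ z, 0 < z → ContinuousAt f z := fun z hz => (hf z hz).continuousAt
  obtain ⟨δ, hδ, hδneg⟩ := hright x hx hfx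
  -- the first zero after `x`
  set x₁ := x + min (δ / 2) ((y - x) / 2) with hx₁
  have hx₁x : x < x₁ := by
    have : 0 < min (δ / 2) ((y - x) / 2) := lt_min (by linarith) (by linarith)
    linarith
  have hx₁y : x₁ ≤ y := by
    have : min (δ / 2) ((y - x) / 2) ≤ (y - x) / 2 := min_le_right _ _
    linarith
  have hx₁δ : x₁ < x + δ := by
    have : min (δ / 2) ((y - x) / 2) ≤ δ / 2 := min_le_left _ _
    linarith
  set S : Set ℝ := Icc x₁ y ∩ f ⁻¹' {0} with hS
  have hSclosed : IsClosed S := by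
    have hc : ContinuousOn f (Icc x₁ y) := fun z hz =>
      (hcont z (hx.trans (hx₁x.trans_le hz.1))).continuousWithinAt
    exact hc.preimage_isClosed_of_isClosed isClosed_Icc isClosed_singleton
  have hyS : y ∈ S := ⟨⟨hx₁y, le_rfl⟩, hfy⟩
  have hSne : S.Nonempty := ⟨y, hyS⟩
  have hSbdd : BddBelow S := ⟨x₁, fun z hz => hz.1.1⟩
  set z₀ := sInf S with hz₀
  have hz₀S : z₀ ∈ S := hSclosed.csInf_mem hSne hSbdd
  have hz₀x₁ : x₁ ≤ z₀ := hz₀S.1.1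
  have hfz₀ : f z₀ = 0 := hz₀S.2
  have hz₀pos : 0 < z₀ := hx.trans (hx₁x.trans_le hz₀x₁)
  -- `f < 0` on `(x, z₀)`
  have hnoroot : ∀ w, x < w → w < z₀ → f w ≠ 0 := by
    intro w hxw hwz hfw
    rcases lt_or_ge w x₁ with h1 | h1
    · exact (hδneg w hxw (h1.trans hx₁δ)).ne hfw
    · have hwS : w ∈ S := ⟨⟨h1, hwz.le.trans hz₀S.1.2⟩, hfw⟩
      have := csInf_le hSbdd hwS
      linarith
  have hnegint : ∀ w, x < w → w < z₀ → f w < 0 := by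
    intro w hxw hwz
    rcases lt_or_ge w (x + δ) with h1 | h1
    · exact hδneg w hxw h1
    · -- compare with the negative point `x₁' := (x + x₁)/2`… use the point `x₁` itself, which is `< x + δ`
      have hfx₁ : f x₁ < 0 := hδneg x₁ hx₁x hx₁δ
      by_contra hge
      push Not at hge
      rcases hge.eq_or_lt with h2 | h2
      · exact hnoroot w hxw hwz h2.symm
      · -- intermediate value on `[x₁, w]`
        have hcw : ContinuousOn f (Icc x₁ w) := fun z hz =>
          (hcont z (hx.trans (hx₁x.trans_le hz.1))).continuousWithinAt
        have hx₁w : x₁ ≤ w := by linarith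
        obtain ⟨r, hr, hfr⟩ := intermediate_value_Icc hx₁w hcw ⟨hfx₁.le, h2.le⟩
        rcases hr.1.eq_or_lt with h3 | h3
        · rw [← h3] at hfr; exact hfx₁.ne hfr
        · exact hnoroot r (hx₁x.trans h3) (hr.2.trans_lt hwz) hfr
  -- but left of the zero `z₀` the function is positive: contradiction
  obtain ⟨δ', hδ', hδ'pos⟩ := hleft z₀ hz₀pos hfz₀
  set w := z₀ - min (δ' / 2) ((z₀ - x) / 2) with hw
  have hm : 0 < min (δ' / 2) ((z₀ - x) / 2) := lt_min (by linarith) (by linarith [hx₁x.trans_le hz₀x₁])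
  have hw1 : z₀ - δ' < w := by
    have : min (δ' / 2) ((z₀ - x) / 2) ≤ δ' / 2 := min_le_left _ _
    linarith
  have hw2 : w < z₀ := by linarith
  have hw3 : x < w := by
    have : min (δ' / 2) ((z₀ - x) / 2) ≤ (z₀ - x) / 2 := min_le_right _ _
    linarith [hx₁x.trans_le hz₀x₁]
  exact absurd (hδ'pos w hw1 hw2) (not_lt.2 (hnegint w hw3 hw2).le)

end ZeroChange

end Summit.ValiantsHypothesis.ValiantsHypothesis.Theorems.LacunarySymmetroidMatrixDescartes
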